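import Mathlib
import Literature.AlgebraicGeometry.Resolution.CobordantGame
import Summits.ResolutionOfSingularities.ResolutionOfSingularities.Theorems.WeightedInvariantLocalWeightedDropGradedGameCoordChange
import Summits.ResolutionOfSingularities.ResolutionOfSingularities.Theorems.WeightedInvariantLocalWeightedDropGradedGamePropagate
import Summits.ResolutionOfSingularities.ResolutionOfSingularities.Theorems.WeightedInvariantLocalWeightedDropGradedSliceRank

/-!
# `WeightedInvariant.LocalWeightedDrop`: THE INVERSE OF A GRADED COORDINATE CHANGE IS GRADED — coordinate-change transfer of graded
# wins with hypotheses on ONE side only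

Route `ResolutionOfSingularities/WeightedInvariant`, crux `LocalWeightedDrop` (stmt-ResolutionOfSingularities-8899).
[OURS · L1 W4.3] — graded-slice package of res-type-060, library layer.  `…GradedGameCoordChange.gradedWonBy_subst_iff` (p512731) asks
for a graded coordinate change `Φ` AND an explicitly graded two-sided inverse `Ψ`; every user so far (tame p515424, wild p525479) had to
build `Ψ` by hand.  Here: if `Φ` has zero constants, invertible linear part and `L`-graded components, then its formal inverse
(`FormalCoordChange.exists_comp_inverse`) is AUTOMATICALLY `L`-graded (`graded_of_inverse`), so the transfer needs `Φ` only
(`gradedWonBy_subst_iff_of_graded`).  Intended consumer: the conjugated moves of the wild rank-0 floor (res-type-099, (S3)).  Nothing here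
is a statement of the manuscript under review on ladder RESOLUTION; not a verdict on card A.  AI proof, weaker than expert review.

Proof of `graded_of_inverse`: split `Ψᵢ = π + r` into the monomials of the character of `yᵢ` and the rest; `Φ`-substitution preserves
«all monomials of that character» and «no monomial of that character» (`exists_exp_of_coeff_subst_ne_zero`); since `Ψᵢ(Φ) = yᵢ` has
only that character, `r(Φ) = 0`, hence `r = r(Φ)(Ψ) = 0`.
-/

set_option linter.dupNamespace false -- mandated namespace of this single-conjunct summit
set_option autoImplicit false

namespace Summit.ResolutionOfSingularities.ResolutionOfSingularities.Theorems

namespace GradedGame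

open MvPowerSeries
open Literature.AlgebraicGeometry.Resolution
open Literature.AlgebraicGeometry.Resolution.FormalCoordChange (linMat exists_comp_inverse)

variable {k : Type} [Field k]

/-- **THE INVERSE OF A GRADED COORDINATE CHANGE IS GRADED.**  If `θ` has zero constant terms, invertible linear part and `L`-graded
components (`θᵢ` has the character of `yᵢ`), and `ψ` is a two-sided compositional inverse with zero constant terms, then `ψ` is
`L`-graded. [OURS · L1 W4.3] -/
theorem graded_of_inverse {m : ℕ} (L : AddSubgroup (Fin m → ℤ)) (θ ψ : Fin m → MvPowerSeries (Fin m) k)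
    (hθ0 : ∀ i, constantCoeff (θ i) = 0) (hθdet : IsUnit (linMat θ).det)
    (hθgr : ∀ i (e : Fin m →₀ ℕ), coeff e (θ i) ≠ 0 → expVec e - Pi.single i 1 ∈ L)
    (hψ0 : ∀ i, constantCoeff (ψ i) = 0)
    (h1 : ∀ s, subst ψ (θ s) = X s) (h2 : ∀ s, subst θ (ψ s) = X s) :
    ∀ i (e : Fin m →₀ ℕ), coeff e (ψ i) ≠ 0 → expVec e - Pi.single i 1 ∈ L := by
  classical
  intro i
  have hmv : IsLGradedMove L θ (fun _ => 1) := ⟨⟨hθ0, hθdet, ⟨i, Nat.one_pos⟩⟩, hθgr⟩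
  have hθs : HasSubst θ := hasSubst_of_constantCoeff_zero hθ0
  have hψs : HasSubst ψ := hasSubst_of_constantCoeff_zero hψ0
  -- split `ψ i` into its part of the character of `y_i` and the rest
  let r : MvPowerSeries (Fin m) k := fun e => if expVec e - Pi.single i 1 ∈ L then 0 else coeff e (ψ i)
  have hcoeff_r : ∀ e, coeff e r = if expVec e - Pi.single i 1 ∈ L then 0 else coeff e (ψ i) := fun e => rfl
  set π : MvPowerSeries (Fin m) k := ψ i - r with hπ
  have hπgr : ∀ e, coeff e π ≠ 0 → expVec e - Pi.single i 1 ∈ L := by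
    intro e he
    by_contra hne
    apply he
    rw [hπ, map_sub, hcoeff_r, if_neg hne, sub_self]
  have hrgr : ∀ e, coeff e r ≠ 0 → expVec e - Pi.single i 1 ∉ L := by
    intro e he hmem
    apply he
    rw [hcoeff_r, if_pos hmem]
  have hA : ∀ e, coeff e (subst θ π) ≠ 0 → expVec e - Pi.single i 1 ∈ L := by
    intro e he
    obtain ⟨d, hd, hed⟩ := exists_exp_of_coeff_subst_ne_zero L hmv π e he
    have := L.add_mem hed (hπgr d hd)
    rwa [sub_add_sub_cancel] at this
  have hB : ∀ e, coeff e (subst θ r) ≠ 0 → expVec e - Pi.single i 1 ∉ L := by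
    intro e he hmem
    obtain ⟨d, hd, hed⟩ := exists_exp_of_coeff_subst_ne_zero L hmv r e he
    apply hrgr d hd
    have := L.sub_mem hmem hed
    rwa [sub_sub_sub_cancel_left] at this
  have hsum : subst θ π + subst θ r = X i := by
    rw [← subst_add hθs, hπ, sub_add_cancel, h2]
  have hθr : subst θ r = 0 := by
    ext e
    rw [map_zero]
    by_cases hmem : expVec e - Pi.single i 1 ∈ L
    · by_contra hne
      exact hB e hne hmem
    · have h := congrArg (coeff e) hsum
      rw [map_add, coeff_X] at h
      have hne : e ≠ Finsupp.single i 1 := by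
        rintro rfl
        apply hmem
        rw [expVec_single, Nat.cast_one, sub_self]
        exact L.zero_mem
      rw [if_neg hne] at h
      have hπ0 : coeff e (subst θ π) = 0 := by
        by_contra hne'
        exact hmem (hA e hne')
      rwa [hπ0, zero_add] at h
  have hr0 : r = 0 := by
    have hback : subst ψ (subst θ r) = r := by
      rw [subst_comp_subst_apply hθs hψs]
      have hX : (fun s => subst ψ (θ s)) = X := by funext s; exact h1 s
      rw [hX, subst_self]
      rfl
    rw [← hback, hθr, ← coe_substAlgHom hψs, map_zero]
  intro e he
  apply hπgr e
  rwa [hπ, hr0, sub_zero]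

/-- The linear part of the identity substitution is the identity matrix. [OURS · L1 W4.3] -/
theorem linMat_X (m : ℕ) : linMat (fun i : Fin m => (X i : MvPowerSeries (Fin m) k)) = 1 := by
  ext i j
  show coeff (Finsupp.single j 1) (X i : MvPowerSeries (Fin m) k) = _
  rw [coeff_X, Matrix.one_apply]
  by_cases h : i = j
  · subst h; simp
  · rw [if_neg (fun h' => h ((Finsupp.single_left_inj one_ne_zero).mp h').symm), if_neg h]

/-- A two-sided inverse has invertible linear part. [OURS · L1 W4.3] -/
theorem isUnit_det_linMat_of_inverse {m : ℕ} (θ ψ : Fin m → MvPowerSeries (Fin m) k)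
    (hθ0 : ∀ i, constantCoeff (θ i) = 0) (h2 : ∀ s, subst θ (ψ s) = X s) : IsUnit (linMat ψ).det := by
  have h := linMat_comp θ ψ hθ0
  have hX : (fun i => subst θ (ψ i)) = fun i : Fin m => (X i : MvPowerSeries (Fin m) k) := funext h2
  rw [hX, linMat_X] at h
  have hdet : (linMat ψ).det * (linMat θ).det = 1 := by rw [← Matrix.det_mul, ← h, Matrix.det_one]
  exact IsUnit.of_mul_eq_one _ hdet

/-- **COORDINATE-CHANGE TRANSFER WITH ONE-SIDED HYPOTHESES**: for a zero-constant, invertible, `L`-graded `Φ` and every rank `α`,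
`f(Φ)` is won in the `L`-graded game with rank `α` iff `f` is (p512731 `gradedWonBy_subst_iff` with the inverse supplied by
`exists_comp_inverse` and graded by `graded_of_inverse`). [OURS · L1 W4.3] -/
theorem gradedWonBy_subst_iff_of_graded (α : Ordinal.{0}) {m : ℕ} (L : AddSubgroup (Fin m → ℤ))
    (f : MvPowerSeries (Fin m) k) (Φ : Fin m → MvPowerSeries (Fin m) k)
    (hΦ0 : ∀ j, constantCoeff (Φ j) = 0) (hΦdet : IsUnit (linMat Φ).det)
    (hΦgr : ∀ j (e : Fin m →₀ ℕ), coeff e (Φ j) ≠ 0 → expVec e - Pi.single j 1 ∈ L) :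
    GradedWonBy α m L (subst Φ f) ↔ GradedWonBy α m L f := by
  obtain ⟨Ψ, hΨ0, hΨ1, hΨ2⟩ := exists_comp_inverse hΦ0 hΦdet
  have hΨgr := graded_of_inverse L Φ Ψ hΦ0 hΦdet hΦgr hΨ0 hΨ1 hΨ2
  have hΨdet : IsUnit (linMat Ψ).det := isUnit_det_linMat_of_inverse Φ Ψ hΦ0 hΨ2
  exact gradedWonBy_subst_iff α L f Φ Ψ hΦ0 hΦdet hΦgr hΨ0 hΨdet hΨgr hΨ1 hΨ2

/-- Forward direction alone: a graded invertible coordinate change transports graded wins (same rank). [OURS · L1 W4.3] -/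
theorem gradedWonBy_subst_of_graded (α : Ordinal.{0}) {m : ℕ} (L : AddSubgroup (Fin m → ℤ))
    (f : MvPowerSeries (Fin m) k) (Φ : Fin m → MvPowerSeries (Fin m) k)
    (hΦ0 : ∀ j, constantCoeff (Φ j) = 0) (hΦdet : IsUnit (linMat Φ).det)
    (hΦgr : ∀ j (e : Fin m →₀ ℕ), coeff e (Φ j) ≠ 0 → expVec e - Pi.single j 1 ∈ L) :
    GradedWonBy α m L f → GradedWonBy α m L (subst Φ f) :=
  (gradedWonBy_subst_iff_of_graded α L f Φ hΦ0 hΦdet hΦgr).mpr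

end GradedGame

end Summit.ResolutionOfSingularities.ResolutionOfSingularities.Theorems
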